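import Summits.ValiantsHypothesis.ValiantsHypothesis.Theorems.BarrierLeverPartitionMinorsHitByVPAdditiveDoor
import Summits.ValiantsHypothesis.ValiantsHypothesis.Theorems.BarrierLeverPartitionMinorsHitByVPOrProjections

/-!
# Route BarrierLever — item `PartitionMinorsHitByVP` (stmt-ValiantsHypothesis-19717):
# the FROBENIUS DOOR with a SYMBOLIC Moore table — every layout whose generalized Vandermonde
# `det [η_{u i}^{bin (w j)}]` is nonzero in `𝔽₂[Y₀, …, Y_h]` is hit

Helper file (`--supports stmt-ValiantsHypothesis-19717`; cell valiant-natproofs, rung V4, 𝒟-side door (c),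
prover seat val-np-p6 gen 5). Closes NO item; definition-free.

The additive door (`AdditiveDoor.partitionMinor_hit_of_additive_mem`, val-np-p6 g3) hits a layout
`(u, w)` as soon as SOME complex table `(ω₀, ω)` makes `det [∏_{c ∈ w j} (ω₀ c + Σ_{a ∈ u i} ω a c)]_{i,j} ≠ 0`.
Engine v3 of val-np-p1 g10 (`…SubsetSumFrobenius`, `…HitByVPBinaryContiguous`) evaluates the INTEGER model
of that matrix in `𝔽₂[t]` at the table `ω a c = t^(a·2^c)`: Frobenius additivity turns every entry into a
power `ξ_{u i}^{bin(w j)}` of the code polynomial `ξ_U = Σ_{k∈U} t^k`, and the matrix into a (generalized)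
Vandermonde — nonsingular when the binary weights `bin (w j) = Σ_{c ∈ w j} 2^c` are CONTIGUOUS.

This file keeps the row elements SYMBOLIC: the MOORE TABLE `ω₀ c = Y_none^(2^c)`, `ω a c = Y_(some a)^(2^c)`
with independent indeterminates `Y` over `ZMod 2`. Frobenius gives the entry
`η_{u i}^{bin (w j)}`, `η_U := Y_none + Σ_{k ∈ U} Y_(some k) ∈ 𝔽₂[Y]` (distinct LINEAR FORMS for distinct `U`),
so the evaluated matrix is the generalized Vandermonde `[η_{u i}^{bin (w j)}]_{i,j}` over the domain `𝔽₂[Y]`.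

* **`det_additiveZ_ne_zero_of_frobenius`** — if that generalized Vandermonde has nonzero determinant in
  `MvPolynomial (Option (Fin h)) (ZMod 2)`, the integer additive matrix
  `[∏_{c ∈ w j} (X_(c,none) + Σ_{a ∈ u i} X_(c,some a))]` has nonzero determinant;
* **`exists_table_of_frobenius`** — hence a numeric complex table with nonzero determinant exists;
* **`partitionMinor_hit_of_frobenius`** (+ mirror `partitionMinor_hit_of_frobenius_rows`) — hence the layout
  is hit inside `SmallCircuits ℂ (h+h) 5` (`h ≥ 2`).

Every specialization `Y ↦ (polynomials in t)` factors through this door, so its reach contains the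
binary-contiguous / block-contiguous classes of val-np-p1; it is strictly larger (rows `{1},{2},{1,3},{2,3}` ×
columns `∅,{a},{b},{a,b,c}`: the code-polynomial Schur factor vanishes, the symbolic one does not). CONJECTURE F2
of the seat memo (RESIDUE-v7): for rows = a Hamming ball `B([h], e)` the symbolic generalized Vandermonde is
nonzero for EVERY injective column family (kit census j281654: exhaustive at `h ≤ 5`, sampled to `h = 10`);
F2 ⇒ conjecture T1 of `…BallUniversal` («ball rows × ANY columns»).

WHAT THIS IS NOT: no class of layouts is claimed unconditionally here beyond what the hypothesis gives; F2 / T1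
are conjectures; nothing on CPM (20172/20195), crux 14610 or VP vs VNP.
-/

set_option linter.dupNamespace false

namespace Summit.ValiantsHypothesis.ValiantsHypothesis.Theorems.BarrierLever.FrobeniusDoor

open Finset MvPolynomial Matrix
open Literature.Barriers.ValiantsHypothesis

noncomputable section

variable {h : ℕ}

/-! ## 1. The Moore evaluation `X_(c, o) ↦ Y_o^(2^c)` and Frobenius additivity -/

/-- **Frobenius additivity.** Under the Moore table `X_(c,o) ↦ Y_o^(2^c)` the symbolic coordinate
`X_(c,none) + Σ_{a∈U} X_(c,some a)` (integer model) becomes `η_U^(2^c)`, `η_U = Y_none + Σ_{a∈U} Y_(some a)`. -/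
theorem moore_lin (c : Fin h) (U : Finset (Fin h)) :
    eval₂Hom (Int.castRingHom (MvPolynomial (Option (Fin h)) (ZMod 2)))
        (fun p : Fin h × Option (Fin h) =>
          (X p.2 : MvPolynomial (Option (Fin h)) (ZMod 2)) ^ 2 ^ (p.1 : ℕ))
        (X (c, none) + ∑ a ∈ U, X (c, some a) : MvPolynomial (Fin h × Option (Fin h)) ℤ) =
      ((X none + ∑ a ∈ U, X (some a) : MvPolynomial (Option (Fin h)) (ZMod 2))) ^ 2 ^ (c : ℕ) := by
  simp only [map_add, map_sum, coe_eval₂Hom, eval₂_X]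
  rw [add_pow_char_pow, sum_pow_char_pow]

/-- The Moore evaluation of the entry `(i, j)` of the integer additive matrix is `η_{u i}^{bin (w j)}`,
`bin W = Σ_{c ∈ W} 2^c`. -/
theorem moore_entry {ι : Type*} (u w : ι → Finset (Fin h)) (i j : ι) :
    eval₂Hom (Int.castRingHom (MvPolynomial (Option (Fin h)) (ZMod 2)))
        (fun p : Fin h × Option (Fin h) =>
          (X p.2 : MvPolynomial (Option (Fin h)) (ZMod 2)) ^ 2 ^ (p.1 : ℕ))
        (∏ c ∈ w j, (X (c, none) + ∑ a ∈ u i, X (c, some a)) :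
          MvPolynomial (Fin h × Option (Fin h)) ℤ) =
      ((X none + ∑ a ∈ u i, X (some a) : MvPolynomial (Option (Fin h)) (ZMod 2))) ^
        (∑ c ∈ w j, 2 ^ (c : ℕ)) := by
  rw [map_prod, ← Finset.prod_pow_eq_pow_sum]
  exact Finset.prod_congr rfl fun c _ => moore_lin c (u i)

/-! ## 2. The door: symbolic generalized Vandermonde ≠ 0 ⇒ integer model ≠ 0 ⇒ numeric table ⇒ hit -/

/-- **Integer model.** If the symbolic generalized Vandermonde `[η_{u i}^{bin (w j)}]` has nonzero determinant
in `𝔽₂[Y]`, the integer additive matrix `[∏_{c ∈ w j} (X_(c,none) + Σ_{a∈u i} X_(c,some a))]` has nonzero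
determinant. -/
theorem det_additiveZ_ne_zero_of_frobenius {ι : Type*} [Fintype ι] [DecidableEq ι]
    (u w : ι → Finset (Fin h))
    (hF : (Matrix.of fun i j : ι =>
      ((X none + ∑ a ∈ u i, X (some a) : MvPolynomial (Option (Fin h)) (ZMod 2))) ^
        (∑ c ∈ w j, 2 ^ (c : ℕ))).det ≠ 0) :
    (Matrix.of fun i j : ι =>
      (∏ c ∈ w j, (X (c, none) + ∑ a ∈ u i, X (c, some a)) :
        MvPolynomial (Fin h × Option (Fin h)) ℤ)).det ≠ 0 := by
  let ψ : MvPolynomial (Fin h × Option (Fin h)) ℤ →+* MvPolynomial (Option (Fin h)) (ZMod 2) :=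
    eval₂Hom (Int.castRingHom (MvPolynomial (Option (Fin h)) (ZMod 2)))
      (fun p : Fin h × Option (Fin h) => (X p.2 : MvPolynomial (Option (Fin h)) (ZMod 2)) ^ 2 ^ (p.1 : ℕ))
  have hmat : ψ.mapMatrix (Matrix.of fun i j : ι =>
      (∏ c ∈ w j, (X (c, none) + ∑ a ∈ u i, X (c, some a)) :
        MvPolynomial (Fin h × Option (Fin h)) ℤ)) =
      Matrix.of fun i j : ι =>
        ((X none + ∑ a ∈ u i, X (some a) : MvPolynomial (Option (Fin h)) (ZMod 2))) ^
          (∑ c ∈ w j, 2 ^ (c : ℕ)) := by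
    refine Matrix.ext fun i j => ?_
    rw [RingHom.mapMatrix_apply, Matrix.map_apply, Matrix.of_apply, Matrix.of_apply]
    exact moore_entry u w i j
  intro h0
  apply hF
  rw [← hmat, ← RingHom.map_det, h0, map_zero]

/-- **Numeric table.** Under the same hypothesis some complex table `(ω₀, ω)` makes the additive matrix
`[∏_{c ∈ w j} (ω₀ c + Σ_{a ∈ u i} ω a c)]_{i,j}` nonsingular — literally the hypothesis of the additive door. -/
theorem exists_table_of_frobenius {ι : Type*} [Fintype ι] [DecidableEq ι]
    (u w : ι → Finset (Fin h))
    (hF : (Matrix.of fun i j : ι =>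
      ((X none + ∑ a ∈ u i, X (some a) : MvPolynomial (Option (Fin h)) (ZMod 2))) ^
        (∑ c ∈ w j, 2 ^ (c : ℕ))).det ≠ 0) :
    ∃ (ω₀ : Fin h → ℂ) (ω : Fin h → Fin h → ℂ),
      (Matrix.of fun i j : ι => ∏ c ∈ w j, (ω₀ c + ∑ a ∈ u i, ω a c)).det ≠ 0 := by
  -- the complex symbolic matrix and its integer model
  have hZ := det_additiveZ_ne_zero_of_frobenius u w hF
  set MC : Matrix ι ι (MvPolynomial (Fin h × Option (Fin h)) ℂ) :=
    Matrix.of fun i j : ι => ∏ c ∈ w j, (X (c, none) + ∑ a ∈ u i, X (c, some a)) with hMC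
  have hmap : MvPolynomial.map (Int.castRingHom ℂ) (Matrix.of fun i j : ι =>
      (∏ c ∈ w j, (X (c, none) + ∑ a ∈ u i, X (c, some a)) :
        MvPolynomial (Fin h × Option (Fin h)) ℤ)).det = MC.det := by
    rw [RingHom.map_det]
    congr 1
    refine Matrix.ext fun i j => ?_
    rw [RingHom.mapMatrix_apply, Matrix.map_apply, Matrix.of_apply, hMC, Matrix.of_apply, map_prod]
    refine Finset.prod_congr rfl fun c _ => ?_
    rw [map_add, map_sum, map_X]
    simp_rw [map_X]
  have hC : MC.det ≠ 0 := by
    intro h0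
    apply hZ
    apply MvPolynomial.map_injective (Int.castRingHom ℂ) Int.cast_injective
    rw [hmap, h0, map_zero]
  -- a point where the complex symbolic determinant does not vanish
  have : ∃ x : Fin h × Option (Fin h) → ℂ, eval x MC.det ≠ 0 := by
    by_contra hcon
    push Not at hcon
    exact hC (MvPolynomial.funext fun x => by rw [hcon x, map_zero])
  obtain ⟨x, hx⟩ := this
  refine ⟨fun c => x (c, none), fun a c => x (c, some a), ?_⟩
  rw [RingHom.map_det] at hx
  convert hx using 2
  ext i j
  simp only [hMC, Matrix.of_apply, RingHom.mapMatrix_apply, Matrix.map_apply, map_prod, map_add, map_sum,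
    eval_X]

/-- **THE FROBENIUS DOOR (symbolic Moore table).** `h ≥ 2`; rows `u`, columns `w : ι → Finset (Fin h)`
(any finite index type). If the generalized Vandermonde `[η_{u i}^{bin (w j)}]_{i,j}`,
`η_U = Y_none + Σ_{a∈U} Y_(some a) ∈ 𝔽₂[Y]`, has nonzero determinant, then the layout `(u, w)` of the Nisan
partition matrix is hit inside `SmallCircuits ℂ (h+h) 5`: `∃ f`, `det [coeff_{x^{u i} y^{w j}} f]_{i,j} ≠ 0`. -/
theorem partitionMinor_hit_of_frobenius {ι : Type*} [Fintype ι] [DecidableEq ι] (hh : 2 ≤ h)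
    (u w : ι → Finset (Fin h))
    (hF : (Matrix.of fun i j : ι =>
      ((X none + ∑ a ∈ u i, X (some a) : MvPolynomial (Option (Fin h)) (ZMod 2))) ^
        (∑ c ∈ w j, 2 ^ (c : ℕ))).det ≠ 0) :
    ∃ f ∈ SmallCircuits ℂ (h + h) 5,
      (Matrix.of fun i j : ι => MvPolynomial.coeff
        (∑ a ∈ u i, Finsupp.single (Fin.castAdd h a) 1 +
          ∑ c ∈ w j, Finsupp.single (Fin.natAdd h c) 1) f).det ≠ 0 := by
  obtain ⟨ω₀, ω, hdet⟩ := exists_table_of_frobenius u w hF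
  exact AdditiveDoor.partitionMinor_hit_of_additive_mem h hh u w ω₀ ω hdet

/-- **Mirror** (`x ↔ y`): if the generalized Vandermonde built from the COLUMN family as nodes and the ROW
family as binary exponents, `[η_{w j}^{bin (u i)}]`, is nonzero in `𝔽₂[Y]`, the layout `(u, w)` is hit
inside `SmallCircuits ℂ (h+h) 5`. -/
theorem partitionMinor_hit_of_frobenius_rows {ι : Type*} [Fintype ι] [DecidableEq ι] (hh : 2 ≤ h)
    (u w : ι → Finset (Fin h))
    (hF : (Matrix.of fun i j : ι =>
      ((X none + ∑ a ∈ w i, X (some a) : MvPolynomial (Option (Fin h)) (ZMod 2))) ^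
        (∑ c ∈ u j, 2 ^ (c : ℕ))).det ≠ 0) :
    ∃ f ∈ SmallCircuits ℂ (h + h) 5,
      (Matrix.of fun i j : ι => MvPolynomial.coeff
        (∑ a ∈ u i, Finsupp.single (Fin.castAdd h a) 1 +
          ∑ c ∈ w j, Finsupp.single (Fin.natAdd h c) 1) f).det ≠ 0 :=
  AdditiveDoor.partitionMinor_hit_symm h 5 u w (partitionMinor_hit_of_frobenius hh w u hF)

/-! ## 3. The nodes `η_U`: injectivity of `U ↦ η_U` and of `d`-th powers -/

/-- Coefficient of `Y_(some a)` in the node `η_U = Y_none + Σ_{a ∈ U} Y_(some a)`: the indicator of `a ∈ U`. -/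
theorem coeff_eta_some (U : Finset (Fin h)) (a : Fin h) :
    coeff (Finsupp.single (some a) 1)
        (X none + ∑ b ∈ U, X (some b) : MvPolynomial (Option (Fin h)) (ZMod 2)) =
      if a ∈ U then 1 else 0 := by
  rw [coeff_add, coeff_sum, coeff_X, if_neg (by
    intro hc
    have := Finsupp.single_eq_single_iff _ _ _ _ |>.mp hc
    simp at this)]
  simp_rw [coeff_X]
  rw [zero_add]
  have : ∀ b : Fin h, (if Finsupp.single (some b) 1 = (Finsupp.single (some a) 1 : Option (Fin h) →₀ ℕ)
      then (1 : ZMod 2) else 0) = if b = a then 1 else 0 := by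
    intro b
    by_cases hb : b = a
    · subst hb; simp
    · rw [if_neg hb, if_neg]
      intro hc
      have := Finsupp.single_eq_single_iff _ _ _ _ |>.mp hc
      simp [hb] at this
  simp_rw [this]
  rw [Finset.sum_ite_eq' U a]

/-- `U ↦ η_U` is injective. -/
theorem eta_injective : Function.Injective fun U : Finset (Fin h) =>
    (X none + ∑ b ∈ U, X (some b) : MvPolynomial (Option (Fin h)) (ZMod 2)) := by
  intro U V hUV
  ext a
  have := congrArg (coeff (Finsupp.single (some a) 1)) hUV
  simp only [coeff_eta_some] at this
  by_cases hU : a ∈ U <;> by_cases hV : a ∈ V <;> simp_all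

/-- The augmentation `Y_none ↦ 1`, `Y_(some a) ↦ 0` sends every node `η_U` to `1`. -/
theorem eval_eta_eq_one (U : Finset (Fin h)) :
    eval (fun o : Option (Fin h) => if o = none then (1 : ZMod 2) else 0)
      (X none + ∑ b ∈ U, X (some b) : MvPolynomial (Option (Fin h)) (ZMod 2)) = 1 := by
  rw [map_add, map_sum, eval_X, if_pos rfl]
  simp [eval_X]

/-- **Odd powers separate the nodes**: for odd `d`, `η_U^d = η_V^d ⇒ U = V`. Proof:
`(Σ_{i<d} η_U^i η_V^(d-1-i)) · (η_U − η_V) = η_U^d − η_V^d = 0` in the domain `𝔽₂[Y]`, and the geometric sum is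
nonzero because the augmentation maps it to `d = 1 ∈ 𝔽₂`. -/
theorem eta_pow_injective_odd {d : ℕ} (hd : Odd d) {U V : Finset (Fin h)}
    (hUV : (X none + ∑ b ∈ U, X (some b) : MvPolynomial (Option (Fin h)) (ZMod 2)) ^ d =
      (X none + ∑ b ∈ V, X (some b) : MvPolynomial (Option (Fin h)) (ZMod 2)) ^ d) : U = V := by
  set x : MvPolynomial (Option (Fin h)) (ZMod 2) := X none + ∑ b ∈ U, X (some b) with hx
  set y : MvPolynomial (Option (Fin h)) (ZMod 2) := X none + ∑ b ∈ V, X (some b) with hy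
  have hgeom := geom_sum₂_mul x y d
  rw [hUV, sub_self] at hgeom
  rcases mul_eq_zero.mp hgeom with hsum | hsub
  · exfalso
    have := congrArg (eval (fun o : Option (Fin h) => if o = none then (1 : ZMod 2) else 0)) hsum
    rw [map_sum, map_zero] at this
    simp_rw [map_mul, map_pow, hx, hy, eval_eta_eq_one, one_pow, mul_one, Finset.sum_const,
      Finset.card_range, nsmul_eq_mul, mul_one] at this
    rw [ZMod.natCast_eq_one_iff_odd.mpr hd] at this
    exact one_ne_zero this
  · exact eta_injective (sub_eq_zero.mp hsub)

/-- **`d`-th powers separate the nodes** (`d ≥ 1`): `η_U^d = η_V^d ⇒ U = V`. Write `d = 2^s · d'` with `d'`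
odd; the iterated Frobenius of the reduced ring `𝔽₂[Y]` is injective, then `eta_pow_injective_odd`. -/
theorem eta_pow_injective {d : ℕ} (hd : d ≠ 0) {U V : Finset (Fin h)}
    (hUV : (X none + ∑ b ∈ U, X (some b) : MvPolynomial (Option (Fin h)) (ZMod 2)) ^ d =
      (X none + ∑ b ∈ V, X (some b) : MvPolynomial (Option (Fin h)) (ZMod 2)) ^ d) : U = V := by
  obtain ⟨s, d', hd', rfl⟩ := Nat.exists_eq_pow_mul_and_not_dvd hd 2 (by norm_num)
  have hodd : Odd d' := Nat.odd_iff.mpr (Nat.two_dvd_ne_zero.mp hd')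
  refine eta_pow_injective_odd hodd ?_
  apply iterateFrobenius_inj (MvPolynomial (Option (Fin h)) (ZMod 2)) 2 s
  rw [iterateFrobenius_def, iterateFrobenius_def, ← pow_mul, ← pow_mul, mul_comm d', hUV]

/-- Every node `η_U` is nonzero (its augmentation is `1`). -/
theorem eta_ne_zero (U : Finset (Fin h)) :
    (X none + ∑ b ∈ U, X (some b) : MvPolynomial (Option (Fin h)) (ZMod 2)) ≠ 0 := by
  intro h0
  have := eval_eta_eq_one U
  rw [h0, map_zero] at this
  exact zero_ne_one this

/-! ## 4. First unconditional class of the symbolic door: ALL rows × ARITHMETIC-PROGRESSION columns -/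

/-- **Symbolic generalized Vandermonde for arithmetic-progression exponents.** If the binary weights of the
columns are `bin (w j) = m₀ + d · σ j` for a permutation `σ` of `Fin r` and a stride `d ≥ 1`, and the rows
`u` are injective, then `det [η_{u i}^{bin (w j)}] ≠ 0` in `𝔽₂[Y]`: the matrix is
`diag(η_{u i}^{m₀}) · Vandermonde(η_{u i}^d)` with columns permuted, and the `η_{u i}^d` are pairwise distinct
(`eta_pow_injective`). -/
theorem frobDet_ne_zero_of_arithmetic {r : ℕ} (u w : Fin r → Finset (Fin h))
    (hu : Function.Injective u) (m₀ d : ℕ) (hd : d ≠ 0) (σ : Equiv.Perm (Fin r))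
    (hw : ∀ j, ∑ c ∈ w j, 2 ^ (c : ℕ) = m₀ + d * (σ j : ℕ)) :
    (Matrix.of fun i j : Fin r =>
      ((X none + ∑ a ∈ u i, X (some a) : MvPolynomial (Option (Fin h)) (ZMod 2))) ^
        (∑ c ∈ w j, 2 ^ (c : ℕ))).det ≠ 0 := by
  set η : Fin r → MvPolynomial (Option (Fin h)) (ZMod 2) :=
    fun i => X none + ∑ a ∈ u i, X (some a) with hη
  have hmat : (Matrix.of fun i j : Fin r =>
      ((X none + ∑ a ∈ u i, X (some a) : MvPolynomial (Option (Fin h)) (ZMod 2))) ^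
        (∑ c ∈ w j, 2 ^ (c : ℕ))) =
      Matrix.of fun i j : Fin r => η i ^ m₀ *
        ((Matrix.vandermonde fun i => η i ^ d).submatrix id σ) i j := by
    refine Matrix.ext fun i j => ?_
    rw [Matrix.of_apply, Matrix.of_apply, Matrix.submatrix_apply, Matrix.vandermonde_apply, hw j, pow_add,
      pow_mul]
    rfl
  rw [hmat, Matrix.det_mul_column, Matrix.det_permute', mul_ne_zero_iff, mul_ne_zero_iff]
  refine ⟨Finset.prod_ne_zero_iff.mpr fun i _ => pow_ne_zero _ (eta_ne_zero (u i)), ?_, ?_⟩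
  · rcases Int.units_eq_one_or (Equiv.Perm.sign σ) with h1 | h1 <;> simp [h1]
  · rw [Matrix.det_vandermonde_ne_zero_iff]
    intro i i' hii'
    exact hu (eta_pow_injective hd hii')

/-- **ALL rows × ARITHMETIC-PROGRESSION columns.** `h ≥ 2`; rows `u : Fin r → Finset (Fin h)` injective and
otherwise arbitrary; columns `w` whose binary weights `Σ_{c ∈ w j} 2^c` are `m₀, m₀ + d, …, m₀ + (r−1)·d` in some
order (`d ≥ 1`; `d = 1` is the binary-contiguous class of `…HitByVPBinaryContiguous`, every odd `d > 1` is new).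
Then `∃ f ∈ SmallCircuits ℂ (h+h) 5` with `det [coeff_{x^{u i} y^{w j}} f] ≠ 0`. -/
theorem partitionMinor_hit_of_arithmeticColumns (hh : 2 ≤ h) {r : ℕ} (u w : Fin r → Finset (Fin h))
    (hu : Function.Injective u) (m₀ d : ℕ) (hd : d ≠ 0) (σ : Equiv.Perm (Fin r))
    (hw : ∀ j, ∑ c ∈ w j, 2 ^ (c : ℕ) = m₀ + d * (σ j : ℕ)) :
    ∃ f ∈ SmallCircuits ℂ (h + h) 5,
      (Matrix.of fun i j : Fin r => MvPolynomial.coeff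
        (∑ a ∈ u i, Finsupp.single (Fin.castAdd h a) 1 +
          ∑ c ∈ w j, Finsupp.single (Fin.natAdd h c) 1) f).det ≠ 0 :=
  partitionMinor_hit_of_frobenius hh u w (frobDet_ne_zero_of_arithmetic u w hu m₀ d hd σ hw)

/-- Mirror: ARITHMETIC-PROGRESSION rows × ALL (injective) columns. -/
theorem partitionMinor_hit_of_arithmeticRows (hh : 2 ≤ h) {r : ℕ} (u w : Fin r → Finset (Fin h))
    (hw : Function.Injective w) (m₀ d : ℕ) (hd : d ≠ 0) (σ : Equiv.Perm (Fin r))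
    (hu : ∀ i, ∑ a ∈ u i, 2 ^ (a : ℕ) = m₀ + d * (σ i : ℕ)) :
    ∃ f ∈ SmallCircuits ℂ (h + h) 5,
      (Matrix.of fun i j : Fin r => MvPolynomial.coeff
        (∑ a ∈ u i, Finsupp.single (Fin.castAdd h a) 1 +
          ∑ c ∈ w j, Finsupp.single (Fin.natAdd h c) 1) f).det ≠ 0 :=
  partitionMinor_hit_of_frobenius_rows hh u w (frobDet_ne_zero_of_arithmetic w u hw m₀ d hd σ hu)

end

end Summit.ValiantsHypothesis.ValiantsHypothesis.Theorems.BarrierLever.FrobeniusDoor
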